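import Literature.Computability.QuantumComplexity.PerSearchGridBrick
import Literature.Computability.QuantumComplexity.PerSearchSizesUniform
import Literature.Computability.Complexity.CapBricks
import HarnessLib

/-!
# The search rounds of AA13 Thm. 4.3 as a counted loop in `FP`, with its register-size invariant

Aaronson–Arkhipov, *The computational complexity of linear optics*, Theory of Computing 9 (2013),
proof of Thm. 4.3, eqs. (4.16)–(4.19) (p. 177): `T = O(n log n)` rounds of the grid search halve the
oracle value until the point can be rounded to `Per(X)/Per(Y)`. In the tree the rounds are
`iterM (searchRound mk g (n+1) X' P_Y) (rounds g n) (0, 0, v₀)` (`PermanentSearch.lean`), replayed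
against a transcript by `replay_iterM_succ` / `replay_searchRound` (`PermanentSearchReplay.lean`).
`PerSearchGridBrick.lean` realises one round on string records (`roundF`, `roundF_running`). This file
iterates it:

* **sizes** — the transcript code shrinks along suffixes (`length_ansEnc_le_of_suffix`), the search
  state of a `USz` state is polynomially bounded (`length_stEnc_le`, from `usz_num_lt`/`usz_den_lt` of
  `PerSearchSizesUniform.lean`), and so is a pending grid query (`length_gridQuery_le`, from
  `roundPt_entry_lt`, `length_encode_matrix_le`, `length_perSqQuery`); the bounds are mirrored by
  genuine polynomials (`denEp`, `numEp`, `entEp`, `LMp`, `stBp`, `qBp`, `SPp`, with `_eval` lemmas) so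
  that they can serve as the growth allowance of a capped loop;
* **the loop** `roundsLoopF G c q₀ z = (loopStep (rcapF (SPp G c q₀) (roundF G c q₀)))^[RB_G(|fstF z|)] z`,
  in `FP` unconditionally (`Brick.loopFn_rcapF_mem_FP`), the cap never acting along the algorithm: the
  indexed invariant `RInv` (a running `USz` state with enough rounds left, or a pending state with a
  bounded query) is preserved by `roundF` (`rinv_step`) and keeps it within the allowance
  (`rinv_bound`), whence `loopModel (rcapF …) = loopModel roundF` (`loopModel_rcapF_indexed`);
* **semantics** — `loopModel_roundF_running`: `k` rounds from `stateEnc [] as m w P_Y st` give the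
  state of `replay (iterM (searchRound (randMaker G c q₀ u) G (m+1) (wmat (m+1) w) P_Y) k st) as`
  (running with the leftover transcript, or pending at the stuck state `stuckSt`), and the assembled
  **`roundsLoopF_apply`** for the full `rounds G m` rounds from `(0, 0, v₀)`.

## References

* S. Aaronson, A. Arkhipov, *The computational complexity of linear optics*, Theory of Computing 9
  (2013), proof of Thm. 4.3, eqs. (4.9)–(4.19) (p. 177).
* S. Arora, B. Barak, *Computational Complexity: A Modern Approach*, CUP 2009, §1.3, §1.4.1 (bounded
  loops, clocked simulation), §3.4 (oracle machines).
-/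

noncomputable section

namespace Literature.Computability.QuantumComplexity

open _root_.Computability Complexity Complexity.Brick Complexity.Plumb Complexity.OracleComp Matrix
  Literature.Computability.AlgebraicComplexity Polynomial

namespace PerSearch

/-! ### Lengths of the record fields -/

/-- An answer is no longer than the code of the transcript holding it. [folklore] -/
theorem length_le_of_mem_encList {a : List Bool} : ∀ {as : List (List Bool)}, a ∈ as → a.length ≤ (encList as).length
  | [], h => by simp at h
  | b :: as, h => by
    rw [encList_cons, length_boolPair]
    rcases List.mem_cons.1 h with rfl | h
    · omega
    · have := length_le_of_mem_encList h; omega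

/-- The code of a suffix is no longer. [folklore] -/
theorem length_encList_le_of_suffix {as as' : List (List Bool)} (h : as' <:+ as) : (encList as').length ≤ (encList as).length := by
  obtain ⟨pre, rfl⟩ := h
  induction pre with
  | nil => simp
  | cons b pre ih => rw [List.cons_append, encList_cons, length_boolPair]; omega

/-- Length of the transcript code. [folklore] -/
theorem length_ansEnc (as : List (List Bool)) : (ansEnc as).length = 2 * as.length + 2 + (encList as).length := by
  rw [ansEnc, length_boolPair]; simp [ones]

/-- **The transcript code of a suffix is no longer.** [folklore] -/
theorem length_ansEnc_le_of_suffix {as as' : List (List Bool)} (h : as' <:+ as) : (ansEnc as').length ≤ (ansEnc as).length := by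
  rw [length_ansEnc, length_ansEnc]
  have h1 := length_encList_le_of_suffix h
  have h2 := h.length_le
  omega

/-- Length of a loop state. [folklore] -/
theorem length_stateEnc (S : List Bool) (as : List (List Bool)) (m : ℕ) (w : List Bool) (PY : ℕ) (st : ℕ × ℚ × ℕ) :
    (stateEnc S as m w PY st).length =
      2 * S.length + 2 + (2 * (ansEnc as).length + 2 + (2 * (fdEnc m w PY).length + 2 + (stEnc st).length)) := by
  simp only [stateEnc, length_boolPair]

/-- **The search state of a `USz` state is polynomially bounded**: with `t ≤ T`, `0 < P_Y ≤ (m+1)!` and a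
value of at most `L` bits, `|stEnc st| ≤ 2T + 4 + 2(4 numE + denE + 6) + L`. [folklore] -/
theorem length_stEnc_le {G m PY T L : ℕ} {st : ℕ × ℚ × ℕ} (husz : USz G m PY st.1 st) (ht : st.1 ≤ T) (hPY0 : 0 < PY)
    (hPYle : PY ≤ (m + 1).factorial) (hv : (encodeNat st.2.2).length ≤ L) :
    (stEnc st).length ≤ 2 * T + 4 + (2 * (4 * numE G m T + denE G m T + 6) + 2 + L) := by
  rw [stEnc, length_boolPair, length_boolPair]
  have h1 : (encodeNat st.1).length ≤ T + 1 := (TM2Pass.length_encodeNat_le_self _).trans (by omega)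
  have h2 : (qEnc st.2.1).length ≤ 4 * numE G m T + denE G m T + 6 := by
    refine (length_qEnc_le _).trans ?_
    have hn := length_encodeNat_le_of_lt_two_pow (usz_num_lt husz hPY0 hPYle ht)
    have hd := length_encodeNat_le_of_lt_two_pow (usz_den_lt husz hPY0 hPYle ht)
    omega
  omega

/-- **A pending grid query is polynomially bounded**: the query of the randomised maker at a grid point of
a `USz` state (`i ≤ 3G`, `t ≤ T`) has length
`≤ 2 (2 LM (m+1) (entE G m T) + 2 + kp(|x|)) + 2 + ellp(|x|)`, `x = inX u`. [cite: AaronsonArkhipovToC2013, proof of Thm. 4.3 (p. 177) with Def. 2.4 (p. 163)] -/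
theorem length_gridQuery_le (G : ℕ) (c q₀ : Polynomial ℕ) (u : List Bool) {m : ℕ} (w : List Bool) {PY T : ℕ} {st : ℕ × ℚ × ℕ}
    (husz : USz G m PY st.1 st) (ht : st.1 ≤ T) (hPY0 : 0 < PY) (hPYle : PY ≤ (m + 1).factorial) {i : ℕ} (hi : i ≤ 3 * G) :
    (randMaker G c q₀ u (m + 1, 2, st.1, i) ⟨m + 1, fun a b => scaledMatrix (wmat (m + 1) w) (roundPt G m PY st i) a b⟩).length ≤
      2 * (2 * LM (m + 1) (entE G m T) + 2 + (kp G q₀).eval (inX u).length) + 2 + (ellp G c q₀).eval (inX u).length := by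
  rw [randMaker_apply, length_perSqQuery]
  have hM := length_encode_matrix_le (fun a b => scaledMatrix (wmat (m + 1) w) (roundPt G m PY st i) a b)
    (fun a b => roundPt_entry_lt (isZeroOne_wmat (m + 1) w) husz hPY0 hPYle ht hi a b)
  have hc := length_chunk_le ((ellp G c q₀).eval (inX u).length)
    (inI u * (NSp G q₀).eval (inX u).length + siteIdx G q₀ (inX u).length (m + 1, 2, st.1, i)) (inR u)
  simp only at hM ⊢
  omega

/-! ### The bounds as polynomials -/

/-- `denE` as a polynomial in the dimension, for a round bound `Tp`. [folklore] -/
def denEp (G : ℕ) (Tp : Polynomial ℕ) : Polynomial ℕ := Tp * (C G + 3 + (X + 1) ^ 2) + 1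

/-- `eval` of `denEp`. [folklore] -/
@[simp] theorem denEp_eval (G : ℕ) (Tp : Polynomial ℕ) (N : ℕ) : (denEp G Tp).eval N = denE G N (Tp.eval N) := by
  simp [denEp, denE]

/-- `numE` as a polynomial. [folklore] -/
def numEp (G : ℕ) (Tp : Polynomial ℕ) : Polynomial ℕ := Tp + (C G + 1 + (X + 1) ^ 2) + denEp G Tp

/-- `eval` of `numEp`. [folklore] -/
@[simp] theorem numEp_eval (G : ℕ) (Tp : Polynomial ℕ) (N : ℕ) : (numEp G Tp).eval N = numE G N (Tp.eval N) := by
  simp [numEp, numE]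

/-- `entE` as a polynomial. [folklore] -/
def entEp (G : ℕ) (Tp : Polynomial ℕ) : Polynomial ℕ := denEp G (Tp + 1) + (Tp + 1 + (C G + 1 + (X + 1) ^ 2) + 2)

/-- `eval` of `entEp`. [folklore] -/
@[simp] theorem entEp_eval (G : ℕ) (Tp : Polynomial ℕ) (N : ℕ) : (entEp G Tp).eval N = entE G N (Tp.eval N) := by
  simp [entEp, entE]

/-- `LM N B` as a polynomial in `N`, for an entry-bit bound `B`. [folklore] -/
def LMp (B : Polynomial ℕ) : Polynomial ℕ := 2 * (X + 1) + 2 + (2 * X + 2 + X * (2 * (2 * X + 2 + X * (2 * (B + 4) + 2)) + 2))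

/-- `eval` of `LMp`. [folklore] -/
@[simp] theorem LMp_eval (B : Polynomial ℕ) (N : ℕ) : (LMp B).eval N = LM N (B.eval N) := by
  simp [LMp, LM]

/-- The bound of the search-state code, as a polynomial in `N = |input|`. [folklore] -/
def stBp (G : ℕ) : Polynomial ℕ := 2 * RBp G + 4 + (2 * (4 * numEp G (RBp G) + denEp G (RBp G) + 6) + 2 + (X + 1))

/-- `eval` of `stBp`. [folklore] -/
theorem stBp_eval (G N : ℕ) :
    (stBp G).eval N = 2 * RB G N + 4 + (2 * (4 * numE G N (RB G N) + denE G N (RB G N) + 6) + 2 + (N + 1)) := by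
  simp [stBp]

/-- The bound of a pending grid query, as a polynomial in `N = |input|`. [folklore] -/
def qBp (G : ℕ) (c q₀ : Polynomial ℕ) : Polynomial ℕ := 2 * (2 * LMp (entEp G (RBp G)) + 2 + kp G q₀) + 2 + ellp G c q₀

/-- `eval` of `qBp`. [folklore] -/
theorem qBp_eval (G : ℕ) (c q₀ : Polynomial ℕ) (N : ℕ) :
    (qBp G c q₀).eval N = 2 * (2 * LM N (entE G N (RB G N)) + 2 + (kp G q₀).eval N) + 2 + (ellp G c q₀).eval N := by
  simp [qBp]

/-- **The growth allowance of the rounds loop**: twice a pending query plus a search state (and slack). [folklore] -/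
def SPp (G : ℕ) (c q₀ : Polynomial ℕ) : Polynomial ℕ := 2 * (qBp G c q₀ + 1) + stBp G + 16

/-- `eval` of `SPp`. [folklore] -/
theorem SPp_eval (G : ℕ) (c q₀ : Polynomial ℕ) (N : ℕ) : (SPp G c q₀).eval N = 2 * ((qBp G c q₀).eval N + 1) + (stBp G).eval N + 16 := by
  simp [SPp]

/-- `denE` is monotone. [folklore] -/
theorem denE_mono {G m m' T T' : ℕ} (hm : m ≤ m') (hT : T ≤ T') : denE G m T ≤ denE G m' T' := by
  unfold denE; gcongr

/-- `numE` is monotone. [folklore] -/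
theorem numE_mono {G m m' T T' : ℕ} (hm : m ≤ m') (hT : T ≤ T') : numE G m T ≤ numE G m' T' := by
  unfold numE; have := denE_mono (G := G) hm hT; gcongr

/-- `entE` is monotone. [folklore] -/
theorem entE_mono {G m m' T T' : ℕ} (hm : m ≤ m') (hT : T ≤ T') : entE G m T ≤ entE G m' T' := by
  unfold entE; have := denE_mono (G := G) hm (Nat.succ_le_succ hT); gcongr

/-- The round count of a level of dimension `m + 1 ≤ N` is at most `RB G N`. [folklore] -/
theorem rounds_le_RB_of_le {G m N : ℕ} (hmN : m + 1 ≤ N) : rounds G m ≤ RB G N :=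
  (rounds_le_RB' G m).trans (RB_mono (by omega))

/-- **The search state bound in polynomial form** (`m + 1 ≤ N`, `t ≤ rounds G m`, value of `≤ N + 1` bits). [folklore] -/
theorem length_stEnc_le_stBp {G m PY N : ℕ} {st : ℕ × ℚ × ℕ} (husz : USz G m PY st.1 st) (ht : st.1 ≤ rounds G m) (hPY0 : 0 < PY)
    (hPYle : PY ≤ (m + 1).factorial) (hv : (encodeNat st.2.2).length ≤ N + 1) (hmN : m + 1 ≤ N) :
    (stEnc st).length ≤ (stBp G).eval N := by
  have hT := rounds_le_RB_of_le (G := G) hmN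
  have h := length_stEnc_le (T := rounds G m) husz ht hPY0 hPYle hv
  rw [stBp_eval]
  have h1 := numE_mono (G := G) (by omega : m ≤ N) hT
  have h2 := denE_mono (G := G) (by omega : m ≤ N) hT
  omega

/-- **The pending query bound in polynomial form** (`m + 1 ≤ N`, `|inX u| ≤ N`, `t ≤ rounds G m`). [folklore] -/
theorem length_gridQuery_le_qBp (G : ℕ) (c q₀ : Polynomial ℕ) {u : List Bool} {m : ℕ} (w : List Bool) {PY N : ℕ} {st : ℕ × ℚ × ℕ}
    (husz : USz G m PY st.1 st) (ht : st.1 ≤ rounds G m) (hPY0 : 0 < PY) (hPYle : PY ≤ (m + 1).factorial) {i : ℕ} (hi : i ≤ 3 * G)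
    (hmN : m + 1 ≤ N) (hx : (inX u).length ≤ N) :
    (randMaker G c q₀ u (m + 1, 2, st.1, i) ⟨m + 1, fun a b => scaledMatrix (wmat (m + 1) w) (roundPt G m PY st i) a b⟩).length ≤
      (qBp G c q₀).eval N := by
  have hT := rounds_le_RB_of_le (G := G) hmN
  have h := length_gridQuery_le G c q₀ u w (T := rounds G m) husz ht hPY0 hPYle hi
  rw [qBp_eval]
  have h1 : LM (m + 1) (entE G m (rounds G m)) ≤ LM N (entE G N (RB G N)) := LM_mono hmN (entE_mono (by omega) hT)
  have h2 : (kp G q₀).eval (inX u).length ≤ (kp G q₀).eval N := TM2Iter.eval_mono _ hx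
  have h3 : (ellp G c q₀).eval (inX u).length ≤ (ellp G c q₀).eval N := TM2Iter.eval_mono _ hx
  omega

/-! ### The capped counted loop -/

/-- **The rounds loop**: `RB_G(|fstF z|)` clocked rounds of the capped round brick on `⟨inp, ⟨counter, state⟩⟩`. [cite: AaronsonArkhipovToC2013, proof of Thm. 4.3, eqs. (4.16)–(4.19) (p. 177)] -/
def roundsLoopF (G : ℕ) (c q₀ : Polynomial ℕ) : List Bool → List Bool := fun z =>
  (loopStep (rcapF (SPp G c q₀) (roundF G c q₀)))^[(RBp G).eval (fstF z).length] z

/-- **`roundsLoopF G c q₀ ∈ FP`** (no growth hypothesis: the body is capped). [cite: AroraBarak2009, §1.3 (bounded loops), §1.4.1] -/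
theorem roundsLoopF_mem_FP (G : ℕ) (c q₀ : Polynomial ℕ) : roundsLoopF G c q₀ ∈ FP :=
  loopFn_rcapF_mem_FP (roundF_mem_FP G c q₀) (SPp G c q₀) (RBp G)

/-- The capped loop follows the loop along an invariant **indexed by the counter** (the variant of
`Brick.loopModel_rcapF_of_invariant` needed when the bound depends on the rounds left). [folklore] -/
theorem loopModel_rcapF_indexed {G : Polynomial ℕ} {body : List Bool → List Bool} {x : List Bool} (P : ℕ → List Bool → Prop)
    (hstep : ∀ (k : ℕ) (s : List Bool), P (k + 1) s → P k (body (boolPair x (boolPair (encodeNat (k + 1)) s))))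
    (hbd : ∀ (k : ℕ) (s : List Bool), P (k + 1) s → (body (boolPair x (boolPair (encodeNat (k + 1)) s))).length ≤ s.length + G.eval x.length) :
    ∀ (k : ℕ) (s : List Bool), P k s → loopModel (rcapF G body) x k s = loopModel body x k s
  | 0, _, _ => rfl
  | k + 1, s, hs => by
    rw [loopModel_rcapF_succ k s (hbd k s hs), loopModel]
    exact loopModel_rcapF_indexed P hstep hbd k _ (hstep k s hs)

/-! ### The invariant of the rounds loop -/

section Invariant

variable (G : ℕ) (c q₀ : Polynomial ℕ) (u A : List Bool) (m : ℕ) (w : List Bool) (PY : ℕ) (as₀ : List (List Bool))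

/-- **The invariant with `k` rounds left**: the state codes a search state `st` (of a `USz` size at its
own round count, value of `≤ |inp| + 1` bits) with a suffix of the initial transcript; either running
with `st.1 + k ≤ rounds G m`, or pending with a query of at most `qBp(|inp|)` symbols. [folklore] -/
def RInv (k : ℕ) (s : List Bool) : Prop :=
  ∃ (S : List Bool) (as : List (List Bool)) (st : ℕ × ℚ × ℕ), s = stateEnc S as m w PY st ∧ as <:+ as₀ ∧ USz G m PY st.1 st ∧
    st.1 ≤ rounds G m ∧ (encodeNat st.2.2).length ≤ (boolPair u A).length + 1 ∧
    ((S = [] ∧ st.1 + k ≤ rounds G m) ∨ ∃ q, S = true :: q ∧ q.length ≤ (qBp G c q₀).eval (boolPair u A).length)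

variable {G c q₀ u A m w PY as₀}
variable (hw : w.length = (m + 1) * (m + 1)) (hPY0 : 0 < PY) (hPYle : PY ≤ (m + 1).factorial)
  (hmN : m + 1 ≤ (boolPair u A).length) (hA : ∀ a ∈ as₀, (encodeNat (decodeNat a)).length ≤ (boolPair u A).length + 1)

/-- The initial state satisfies the invariant with all rounds left. [folklore] -/
theorem rinv_init {v0 : ℕ} (hv0 : (encodeNat v0).length ≤ (boolPair u A).length + 1) :
    RInv G c q₀ u A m w PY as₀ (rounds G m) (stateEnc [] as₀ m w PY (0, 0, v0)) :=
  ⟨[], as₀, (0, 0, v0), rfl, List.suffix_refl _, usz_init G m PY v0, Nat.zero_le _, hv0, Or.inl ⟨rfl, by simp⟩⟩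

include hw hPY0 hPYle hmN hA in
/-- **The round preserves the invariant** (one round fewer left). [folklore] -/
theorem rinv_step (k : ℕ) (s : List Bool) (hs : RInv G c q₀ u A m w PY as₀ (k + 1) s) :
    RInv G c q₀ u A m w PY as₀ k (roundF G c q₀ (boolPair (boolPair u A) (boolPair (encodeNat (k + 1)) s))) := by
  obtain ⟨S, as, st, rfl, hsuf, husz, ht, hv, hcase⟩ := hs
  rcases hcase with ⟨rfl, hk⟩ | ⟨q, rfl, hq⟩
  · -- running
    rw [roundF_running G c q₀ u A _ m hw hPY0 st as]
    rcases hro : replay (searchRound (randMaker G c q₀ u) G (m + 1) (wmat (m + 1) w) PY st) as with q | ⟨st', as'⟩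
    · -- stuck: pending with the grid query number `|as| ≤ 3G`
      have hcl := hro
      rw [replay_searchRound] at hcl
      by_cases hv0 : st.2.2 = 0
      · rw [if_pos hv0] at hcl; cases hcl
      · rw [if_neg hv0] at hcl
        by_cases hl : 3 * G + 1 ≤ as.length
        · rw [if_pos hl] at hcl; cases hcl
        · rw [if_neg hl] at hcl
          simp only [Sum.inl.injEq] at hcl
          refine ⟨_, [], st, rfl, List.nil_suffix, husz, ht, hv, Or.inr ⟨q, rfl, ?_⟩⟩
          rw [← hcl]
          exact length_gridQuery_le_qBp G c q₀ w husz ht hPY0 hPYle (by omega) hmN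
            ((length_inX_le u).trans (by rw [length_boolPair]; omega))
    · -- finished: the new state
      obtain ⟨husz', ht', hv', hsuf'⟩ := searchRound_usz hPY0 (randMaker G c q₀ u) (m + 1) (wmat (m + 1) w) husz hro
      refine ⟨[], as', st', rfl, hsuf'.trans hsuf, by rwa [ht'], by omega, ?_, Or.inl ⟨rfl, by omega⟩⟩
      rcases hv' with hv' | ⟨a, ha, hva⟩
      · rw [hv']; exact hv
      · rw [hva]; exact hA a (hsuf.subset ha)
  · -- pending: idle
    rw [stateEnc, roundF_idle G c q₀ _ _ (List.cons_ne_nil _ _)]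
    exact ⟨true :: q, as, st, rfl, hsuf, husz, ht, hv, Or.inr ⟨q, rfl, hq⟩⟩

include hw hPY0 hPYle hmN hA in
/-- **The round stays within the growth allowance** on states of the invariant. [folklore] -/
theorem rinv_bound (k : ℕ) (s : List Bool) (hs : RInv G c q₀ u A m w PY as₀ (k + 1) s) :
    (roundF G c q₀ (boolPair (boolPair u A) (boolPair (encodeNat (k + 1)) s))).length ≤
      s.length + (SPp G c q₀).eval (boolPair u A).length := by
  obtain ⟨S, as, st, rfl, hsuf, husz, ht, hv, hcase⟩ := hs
  rw [SPp_eval]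
  rcases hcase with ⟨rfl, hk⟩ | ⟨q, rfl, hq⟩
  · rw [roundF_running G c q₀ u A _ m hw hPY0 st as]
    rcases hro : replay (searchRound (randMaker G c q₀ u) G (m + 1) (wmat (m + 1) w) PY st) as with q | ⟨st', as'⟩
    · -- pending: the status grows by the query, the transcript empties
      have hcl := hro
      rw [replay_searchRound] at hcl
      by_cases hv0 : st.2.2 = 0
      · rw [if_pos hv0] at hcl; cases hcl
      · rw [if_neg hv0] at hcl
        by_cases hl : 3 * G + 1 ≤ as.length
        · rw [if_pos hl] at hcl; cases hcl
        · rw [if_neg hl] at hcl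
          simp only [Sum.inl.injEq] at hcl
          have hq : q.length ≤ (qBp G c q₀).eval (boolPair u A).length := by
            rw [← hcl]
            exact length_gridQuery_le_qBp G c q₀ w husz ht hPY0 hPYle (by omega) hmN
              ((length_inX_le u).trans (by rw [length_boolPair]; omega))
          dsimp only
          rw [length_stateEnc, length_stateEnc]
          have hA0 : (ansEnc ([] : List (List Bool))).length ≤ (ansEnc as).length := length_ansEnc_le_of_suffix (List.nil_suffix)
          simp only [List.length_cons, List.length_nil]
          omega
    · -- finished: the transcript shrinks, the new search state is bounded absolutely
      obtain ⟨husz', ht', hv', hsuf'⟩ := searchRound_usz hPY0 (randMaker G c q₀ u) (m + 1) (wmat (m + 1) w) husz hro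
      dsimp only
      rw [length_stateEnc, length_stateEnc]
      have h1 := length_ansEnc_le_of_suffix hsuf'
      have hvb : (encodeNat st'.2.2).length ≤ (boolPair u A).length + 1 := by
        rcases hv' with hv' | ⟨a, ha, hva⟩
        · rw [hv']; exact hv
        · rw [hva]; exact hA a (hsuf.subset ha)
      have h2 := length_stEnc_le_stBp (G := G) (by rwa [ht']) (by omega) hPY0 hPYle hvb hmN
      simp only [List.length_nil]
      omega
  · rw [stateEnc, roundF_idle G c q₀ _ _ (List.cons_ne_nil _ _)]
    simp only [length_boolPair]
    omega

end Invariant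

/-! ### Semantics of the loop -/

/-- The state at which the replay of the rounds gets stuck (the pre-round state of the stuck round). [folklore] -/
def stuckSt (mk : Maker) (G m : ℕ) (X : Matrix (Fin (m + 1)) (Fin (m + 1)) ℤ) (PY : ℕ) : ℕ → (ℕ × ℚ × ℕ) → List (List Bool) → ℕ × ℚ × ℕ
  | 0, st, _ => st
  | k + 1, st, as =>
    match replay (searchRound mk G (m + 1) X PY st) as with
    | Sum.inl _ => st
    | Sum.inr (st', as') => stuckSt mk G m X PY k st' as'

/-- A pending state is fixed by the rounds. [folklore] -/
theorem loopModel_roundF_pending (G : ℕ) (c q₀ : Polynomial ℕ) (inp : List Bool) (q : List Bool) (rest : List Bool) :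
    ∀ k : ℕ, loopModel (roundF G c q₀) inp k (boolPair (true :: q) rest) = boolPair (true :: q) rest
  | 0 => rfl
  | k + 1 => by rw [loopModel, roundF_idle G c q₀ _ _ (List.cons_ne_nil _ _), loopModel_roundF_pending G c q₀ inp q rest k]

/-- **The rounds from a running state replay `iterM searchRound`**: running with the leftover transcript
when the replay finishes, pending (transcript exhausted) at the stuck state otherwise. [cite: AaronsonArkhipovToC2013, proof of Thm. 4.3, eqs. (4.16)–(4.19) (p. 177)] -/
theorem loopModel_roundF_running (G : ℕ) (c q₀ : Polynomial ℕ) (u A : List Bool) (m : ℕ) {w : List Bool}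
    (hw : w.length = (m + 1) * (m + 1)) {PY : ℕ} (hPY0 : 0 < PY) :
    ∀ (k : ℕ) (st : ℕ × ℚ × ℕ) (as : List (List Bool)),
      loopModel (roundF G c q₀) (boolPair u A) k (stateEnc [] as m w PY st) =
        match replay (iterM (searchRound (randMaker G c q₀ u) G (m + 1) (wmat (m + 1) w) PY) k st) as with
        | Sum.inr (st', as') => stateEnc [] as' m w PY st'
        | Sum.inl q => stateEnc (true :: q) [] m w PY (stuckSt (randMaker G c q₀ u) G m (wmat (m + 1) w) PY k st as)
  | 0, st, as => by simp [loopModel]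
  | k + 1, st, as => by
    rw [loopModel, roundF_running G c q₀ u A _ m hw hPY0 st as, replay_iterM_succ, stuckSt]
    rcases replay (searchRound (randMaker G c q₀ u) G (m + 1) (wmat (m + 1) w) PY st) as with q | ⟨st', as'⟩
    · dsimp only
      rw [stateEnc, loopModel_roundF_pending]
    · exact loopModel_roundF_running G c q₀ u A m hw hPY0 k st' as'

/-- **The rounds loop on the initial state**: `rounds G m` rounds from `(0, 0, v₀)` give the state of the
replay of the rounds of `levelPost` (conditions: `|w| = (m+1)²`, `0 < P_Y ≤ (m+1)!`, `m + 1 ≤ |inp|`, the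
first value and all transcript values of at most `|inp| + 1` bits). [cite: AaronsonArkhipovToC2013, proof of Thm. 4.3, eqs. (4.16)–(4.19) (p. 177)] -/
theorem roundsLoopF_apply (G : ℕ) (c q₀ : Polynomial ℕ) (u A : List Bool) (m : ℕ) {w : List Bool} (hw : w.length = (m + 1) * (m + 1))
    {PY : ℕ} (hPY0 : 0 < PY) (hPYle : PY ≤ (m + 1).factorial) (hmN : m + 1 ≤ (boolPair u A).length) {v0 : ℕ}
    (hv0 : (encodeNat v0).length ≤ (boolPair u A).length + 1) {as₀ : List (List Bool)}
    (hA : ∀ a ∈ as₀, (encodeNat (decodeNat a)).length ≤ (boolPair u A).length + 1) :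
    roundsLoopF G c q₀ (boolPair (boolPair u A) (boolPair (encodeNat (rounds G m)) (stateEnc [] as₀ m w PY (0, 0, v0)))) =
      boolPair (boolPair u A) (boolPair []
        (match replay (iterM (searchRound (randMaker G c q₀ u) G (m + 1) (wmat (m + 1) w) PY) (rounds G m) (0, 0, v0)) as₀ with
        | Sum.inr (st', as') => stateEnc [] as' m w PY st'
        | Sum.inl q => stateEnc (true :: q) [] m w PY (stuckSt (randMaker G c q₀ u) G m (wmat (m + 1) w) PY (rounds G m) (0, 0, v0) as₀))) := by
  have hrounds : rounds G m ≤ (RBp G).eval (fstF (boolPair (boolPair u A) (boolPair (encodeNat (rounds G m))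
      (stateEnc [] as₀ m w PY (0, 0, v0))))).length := by
    rw [fstF_boolPair, RBp_eval]
    exact rounds_le_RB_of_le hmN
  rw [roundsLoopF, iterate_loopStep _ _ _ _ _ hrounds,
    loopModel_rcapF_indexed (RInv G c q₀ u A m w PY as₀) (rinv_step hw hPY0 hPYle hmN hA) (rinv_bound hw hPY0 hPYle hmN hA)
      _ _ (rinv_init hv0),
    loopModel_roundF_running G c q₀ u A m hw hPY0]

end PerSearch

end Literature.Computability.QuantumComplexity

end
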